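import Summits.HodgeConjecture.CorCM.MultiFieldWeilPrimeDegreesOutsideClosures
import Summits.HodgeConjecture.CorCM.MultiFieldWeilNonIsomorphicDecics
import HarnessLib

/-!
# MULTI-FIELD WEIL ENGINE — NON-ISOMORPHIC DECIC CM FIELDS THROUGH `k` LIE OUTSIDE EACH OTHER'S GALOIS CLOSURES;
# ANY NUMBER OF `(2,3)`-FIVEFOLDS OVER PAIRWISE NON-ISOMORPHIC DECIC CM FIELDS, GIVEN ONLY MARKMAN'S HYPERBOLIC-SIXFOLD THEOREM

Cell `pub-hodgecm2` (COR-CM), seat b30 gen 38 (2026-08-25); count-neutral own lane MULTI-FIELD WEIL ENGINE (stem `MultiFieldWeil*`), sequel of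
`CorCM/MultiFieldWeilPrimeDegreesOutsideClosures.lean` (W1: prime relative degrees — ONE value outside a Galois closure gives stabiliser-transitivity; §3 there:
the SEXTIC case of the present §1) and `CorCM/MultiFieldWeilNonIsomorphicDecics.lean` (gen 32: two relative quintics without homomorphisms are linearly disjoint,
`finrank_adjoin_pair_of_isEmpty_ringHom_five`).  Theorems only; no definition, no named fact, no `sorry`.  HONEST FRAMING: the headline (§2) is conditional ONLY on
the displayed binder `Markman2025_weilClasses_algebraic_hyperbolicSixfold`; `HC_CM` is NOT proved and not asserted.

§1 **THE DECIC CASE OF W1 §3, BY DODSON'S IMPRIMITIVITY BOUND** (`exists_apply_not_mem_normalClosure_of_isEmpty_ringHom_five`).  `k = Kf i₀` imaginary quadratic,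
`K_m`, `K_{m₀}` DECIC CM fields containing `k` via `i_m`, `i_{m₀}`, with NO ring homomorphism `K_m → K_{m₀}`.  Then EVERY `τ`-embedding `s` of `K_m` takes a value
outside the Galois closure `L(K_{m₀})` of `K_{m₀}` in `ℂ`.  Otherwise `ℚ(τk)·u(K_{m₀})·s(K_m) ⊆ L(K_{m₀})` for a `τ`-embedding `u` of `K_{m₀}`; the left side has
degree `50 = 25·[k:ℚ]` (gen 32's quintic degree chase `finrank_adjoin_pair_of_isEmpty_ringHom_five`), while the Galois closure of a DECIC CM field has degree dividing
`2⁵ · 5! = 3840` (`finrank_normalClosure_dvd_of_decic`, from the tree's `Literature…ImprimitivityBound.finrank_dvd_two_pow_mul_factorial_cm` — Dodson's theorem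
`Gal(L/ℚ) ≤ (ℤ/2)⁵ ⋊ 𝔖₅`), and `25 ∤ 3840`.  (The sextic case used `18 ∤ 12`; the argument needs no description of the quintic part of `Gal(L/ℚ)`.)
Pairwise form `outside_closures_of_pairwise_isEmpty_ringHom_five`.

§2 **HEADLINE `hodgeConjectureFor_biproduct_comp_of_decics_of_isEmpty_ringHom`**: `E = A 0 ⊨ (k; {τ})` and ANY NUMBER of `(2,3)`-FIVEFOLDS `F_m = A (m+1) ⊨ (K_m; Φ (m+1))`
over DECIC CM fields `K_m ⊇ i_m(k)` (two members of `Φ (m+1)` over `τ`: Weil-type CM fivefolds), PAIRWISE WITHOUT ring homomorphisms (`Hom(K_m, K_{m₀}) = ∅` for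
`m₀ ≠ m`, i.e. pairwise non-isomorphic; Galois or not, any quintic part): the Hodge conjecture for EVERY product of copies `E^a × ∏_m F_m^{b_m}` GIVEN ONLY Markman's
hyperbolic-sixfold theorem (V2's `hodgeConjectureFor_biproduct_comp_of_stabiliserTransitive` with `hST` from W1's `stabiliserTransitive_of_outside_primes` and §1,
single-slot Weil planes from `weilHyp_of_markman_sixfold_decic_intrinsic`).  This is gen 32's two-field theorem `hodgeConjectureFor_biproduct_comp_of_two_decics_of_isEmpty`
for ANY number of fields, and the decic tower `hodgeConjectureFor_biproduct_comp_of_decics_of_quinticTower` with its tower ∕ non-embedding hypothesis DISCHARGED by the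
pairwise, order-free condition `Hom = ∅`.  (Example: `k` any imaginary quadratic field, `K_m = k·F_m` for pairwise non-isomorphic totally real quintic fields `F_m`.)
NOT covered, honestly: non-isogenous fivefolds over ISOMORPHIC decic fields (two `(2,3)`-types of ONE field: the `DecicWeil23*` files need a `2`-transitive ∕ dihedral
quintic part), `k`-signatures `(1,4)` (the Weil space of `F × E³` in degree `4` is not supplied by Markman's theorems).

[cite: Dodson1984, §1.1 Imprimitivity Theorem] [cite: Lang2002, V §1 Prop. 1.2, VI §1 Thm. 1.1 and Cor. 1.6] [cite: Shimura1998, §18.2 Lemma (i)]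
[cite: DixonMortimer1996, §1.6, Thm. 1.6A] [cite: Markman2025SecantWeil, Thm 1.5.1] [cite: Pohlmann1968, Thm 1] [cite: MoonenZarhin1995Duke, Thm. 2.4] [cite: MumfordAV1970, §19]

## References
* [Dodson1984] B. Dodson, *The structure of Galois groups of CM-fields*, Trans. AMS 283 (1984), §1.1 Imprimitivity Theorem (p. 3).
* [Lang2002] S. Lang, *Algebra*, GTM 211, V §1 Prop. 1.2 (tower law), VI §1 Thm. 1.1, Cor. 1.6.  [Shimura1998] G. Shimura, *Abelian varieties with complex multiplication
  and modular functions*, §18.2 Lemma (i).  [DixonMortimer1996] J. D. Dixon, B. Mortimer, *Permutation Groups*, GTM 163, §1.6, Thm. 1.6A.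
* [Markman2025SecantWeil] E. Markman, Cycles on abelian 2n-folds of Weil type from secant sheaves on abelian n-folds, Thm 1.5.1 (the hyperbolic-sixfold theorem, displayed
  binder).  [Pohlmann1968] H. Pohlmann, Ann. of Math. 88 (1968), Thm 1.  [MoonenZarhin1995Duke] B. Moonen, Yu. Zarhin, Duke Math. J. 77 (1995), Thm. 2.4.  [MumfordAV1970]
  D. Mumford, *Abelian Varieties*, §19.
-/

noncomputable section

open CategoryTheory CategoryTheory.Limits NumberField IntermediateField

namespace Summit.HodgeConjecture.CorCM.MultiFieldWeil

open Finset
open Literature.AlgebraicGeometry Literature.AlgebraicGeometry.Motives Literature.AlgebraicGeometry.HodgeTheory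
open Literature.AlgebraicGeometry.ComplexMultiplication (IsCMTypeRealisation)
open Literature.AlgebraicTopology.SingularHomology
open Literature.NumberTheory.ComplexMultiplication
open Summit.HodgeConjecture.CorCM.Census.MultiFieldWeil

open scoped Classical

/-! ## §1 The Galois closure of a decic CM field has degree dividing `3840`; non-isomorphic decic CM fields through `k` -/

section Decic

variable {I : Type} {r : ℕ} {Kf : I → Type} [∀ i, Field (Kf i)] [∀ i, NumberField (Kf i)] [∀ i, IsCMField (Kf i)]
  {i₀ : I} {is : Fin r → I} {τ : Kf i₀ →+* ℂ}

/-- **The Galois closure in `ℂ` of a DECIC CM field has degree dividing `3840 = 2⁵ · 5!`** (Dodson's imprimitivity bound `[L:ℚ] ∣ 2ⁿ · n!`, `2n = [K:ℚ]`, for the CM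
normal closure `L = normalClosure ℚ K ℂ`). [cite: Dodson1984, §1.1 Imprimitivity Theorem] -/
theorem finrank_normalClosure_dvd_of_decic (i : I) (h10 : Module.finrank ℚ (Kf i) = 10) : Module.finrank ℚ ↥(normalClosure ℚ (Kf i) ℂ) ∣ 3840 := by
  haveI : NumberField ↥(normalClosure ℚ (Kf i) ℂ) := NumberField.mk
  haveI : IsNormalClosure ℚ (Kf i) ↥(normalClosure ℚ (Kf i) ℂ) :=
    Algebra.IsAlgebraic.isNormalClosure_normalClosure fun x => IsAlgClosed.splits _
  haveI : IsCMField ↥(normalClosure ℚ (Kf i) ℂ) := isCMField_of_isNormalClosure (K := Kf i) (L := ↥(normalClosure ℚ (Kf i) ℂ))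
  have h := finrank_dvd_two_pow_mul_factorial_cm (L := ↥(normalClosure ℚ (Kf i) ℂ)) (Kf i)
  rw [h10] at h
  exact h

/-- In particular `25 ∤ [L:ℚ]` for the Galois closure `L` in `ℂ` of a decic CM field (`3840 = 2⁸ · 3 · 5`). [cite: Dodson1984, §1.1 Imprimitivity Theorem] -/
theorem not_twentyfive_dvd_finrank_normalClosure_of_decic (i : I) (h10 : Module.finrank ℚ (Kf i) = 10) :
    ¬ 25 ∣ Module.finrank ℚ ↥(normalClosure ℚ (Kf i) ℂ) := fun h25 =>
  absurd (h25.trans (finrank_normalClosure_dvd_of_decic i h10)) (by norm_num)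

/-- **NON-ISOMORPHIC DECIC CM FIELDS THROUGH `k` LIE OUTSIDE EACH OTHER'S GALOIS CLOSURES.**  `k = Kf i₀` imaginary quadratic, `K_m = Kf (is m)`, `K_{m₀} = Kf (is m₀)`
DECIC CM fields containing `k` via `i_m`, `i_{m₀}`, with NO ring homomorphism `K_m → K_{m₀}`.  Then every `τ`-embedding `s` of `K_m` takes a value outside the Galois
closure `L(K_{m₀})` of `K_{m₀}` in `ℂ`: otherwise `ℚ(τk)·u(K_{m₀})·s(K_m) ⊆ L(K_{m₀})` for a `τ`-embedding `u` of `K_{m₀}`, a subfield of degree `50`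
(`finrank_adjoin_pair_of_isEmpty_ringHom_five`) of a field of degree dividing `3840` (`finrank_normalClosure_dvd_of_decic`); `25 ∤ 3840`.
[cite: Dodson1984, §1.1 Imprimitivity Theorem] [cite: Lang2002, V §1 Prop. 1.2 and VI §1 Thm. 1.1] -/
theorem exists_apply_not_mem_normalClosure_of_isEmpty_ringHom_five (h2 : Module.finrank ℚ (Kf i₀) = 2) (im : ∀ m : Fin r, Kf i₀ →+* Kf (is m))
    {m₀ m : Fin r} (h10₀ : Module.finrank ℚ (Kf (is m₀)) = 10) (h10 : Module.finrank ℚ (Kf (is m)) = 10) (hK : IsEmpty (Kf (is m) →+* Kf (is m₀)))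
    (s : Kf (is m) →+* ℂ) (hs : s.comp (im m) = τ) : ∃ x, s x ∉ normalClosure ℚ (Kf (is m₀)) ℂ := by
  by_contra hall
  push Not at hall
  -- a `τ`-embedding `u` of `K_{m₀}`
  obtain ⟨u, hu⟩ : ∃ u : Kf (is m₀) →+* ℂ, u.comp (im m₀) = τ := by
    have hc := SexticOcticWeil.card_filter_comp_eq_of_finrank (n := 5) (im m₀) (by rw [h10₀]) h2 τ
    obtain ⟨u, hu⟩ := Finset.card_pos.1 (by rw [hc]; exact Nat.succ_pos 4)
    exact ⟨u, (Finset.mem_filter.1 hu).2⟩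
  -- the compositum `ℚ(τk)·u(K_{m₀})·s(K_m)` lies in `L(K_{m₀})`
  have hle : adjoin ℚ (Set.range τ) ⊔ adjoin ℚ (Set.range u ∪ Set.range s) ≤ normalClosure ℚ (Kf (is m₀)) ℂ := by
    refine sup_le (adjoin_le_iff.2 ?_) (adjoin_le_iff.2 ?_)
    · rintro _ ⟨y, rfl⟩
      rw [← hu]
      exact ringHom_apply_mem_normalClosure u _
    · rintro _ (⟨y, rfl⟩ | ⟨y, rfl⟩)
      exacts [ringHom_apply_mem_normalClosure u y, hall y]
  -- degrees: `50 ∣ [L(K_{m₀}):ℚ] ∣ 3840`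
  have h50 : Module.finrank ℚ ↥(adjoin ℚ (Set.range τ) ⊔ adjoin ℚ (Set.range u ∪ Set.range s)) = 25 * Module.finrank ℚ (Kf i₀) :=
    finrank_adjoin_pair_of_isEmpty_ringHom_five (im m₀) (im m) (by rw [h10₀, h2]) (by rw [h10, h2]) hK hu hs
  have hdvd := IntermediateField.finrank_dvd_of_le_right hle
  rw [h50, h2] at hdvd
  exact not_twentyfive_dvd_finrank_normalClosure_of_decic (Kf := Kf) (is m₀) h10₀ ((dvd_mul_right 25 2).trans hdvd)

/-- **Pairwise form**: pairwise `Hom(K_m, K_{m₀}) = ∅` (`m₀ ≠ m`) for decic CM fields through `k` gives the hypothesis `hout` of W1 ∕ V2 — every `τ`-embedding of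
`K_m` takes a value outside `L(K_{m₀})`. [cite: Dodson1984, §1.1 Imprimitivity Theorem] [cite: Lang2002, VI §1 Thm. 1.1] -/
theorem outside_closures_of_pairwise_isEmpty_ringHom_five (h2 : Module.finrank ℚ (Kf i₀) = 2) (h10 : ∀ m : Fin r, Module.finrank ℚ (Kf (is m)) = 10)
    (im : ∀ m : Fin r, Kf i₀ →+* Kf (is m)) (hiso : ∀ (m₀ m : Fin r), m₀ ≠ m → IsEmpty (Kf (is m) →+* Kf (is m₀)))
    (m₀ m : Fin r) (hm : m₀ ≠ m) (s : Kf (is m) →+* ℂ) (hs : s.comp (im m) = τ) : ∃ x, s x ∉ normalClosure ℚ (Kf (is m₀)) ℂ :=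
  exists_apply_not_mem_normalClosure_of_isEmpty_ringHom_five h2 im (h10 m₀) (h10 m) (hiso m₀ m hm) s hs

/-- **`hout` in the existential form used by W1** (some `τ`-embedding with some value outside): from the universal form, since each slot has a `τ`-embedding.
[cite: Dodson1984, §1.1 Imprimitivity Theorem] -/
theorem exists_outside_closures_of_pairwise_isEmpty_ringHom_five (h2 : Module.finrank ℚ (Kf i₀) = 2) (h10 : ∀ m : Fin r, Module.finrank ℚ (Kf (is m)) = 10)
    (im : ∀ m : Fin r, Kf i₀ →+* Kf (is m)) (hiso : ∀ (m₀ m : Fin r), m₀ ≠ m → IsEmpty (Kf (is m) →+* Kf (is m₀)))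
    (m₀ m : Fin r) (hm : m₀ ≠ m) : ∃ s : Kf (is m) →+* ℂ, s.comp (im m) = τ ∧ ∃ x, s x ∉ normalClosure ℚ (Kf (is m₀)) ℂ := by
  have hc := SexticOcticWeil.card_filter_comp_eq_of_finrank (n := 5) (im m) (by rw [h10 m]) h2 τ
  obtain ⟨s, hs⟩ := Finset.card_pos.1 (by rw [hc]; exact Nat.succ_pos 4)
  exact ⟨s, (Finset.mem_filter.1 hs).2, outside_closures_of_pairwise_isEmpty_ringHom_five h2 h10 im hiso m₀ m hm s (Finset.mem_filter.1 hs).2⟩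

end Decic

/-! ## §2 Headline: any number of `(2,3)`-fivefolds over pairwise non-isomorphic decic CM fields through `k`, Markman's sixfold theorem alone -/

section Headline

variable {I : Type} {r : ℕ} {Kf : I → Type} [∀ i, Field (Kf i)] [∀ i, NumberField (Kf i)] [∀ i, IsCMField (Kf i)]
  {i₀ : I} {is : Fin r → I} {τ : Kf i₀ →+* ℂ}
  {A : Fin (r + 1) → AbelianVariety ℂ} {Φ : ∀ j : Fin (r + 1), CMType (Kf (mfSlots i₀ is j))}
  {ι : ∀ j, 𝓞 (Kf (mfSlots i₀ is j)) →+* End (A j)}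
  {θ : ∀ j, Kf (mfSlots i₀ is j) →+* Module.End ℂ (complexBetti (A j).X 1)}

/-- **HEADLINE — ANY NUMBER OF DECIC CM FIELDS THROUGH `k`, EACH WITH A `τ`-EMBEDDING TAKING A VALUE OUTSIDE THE GALOIS CLOSURE OF EACH OTHER, GIVEN ONLY MARKMAN'S
HYPERBOLIC-SIXFOLD THEOREM.**  `k = Kf i₀` imaginary quadratic, `E = A 0 ⊨ (k; {τ})`, `F_m = A (m+1) ⊨ (K_m; Φ (m+1))` over DECIC CM fields `K_m ⊇ i_m(k)` with TWO
members of `Φ (m+1)` over `τ` (`(2,3)`-fivefolds); for `m₀ ≠ m` some `τ`-embedding of `K_m` takes some value outside `L(K_{m₀})`.  Then the Hodge conjecture holds for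
EVERY product of copies `⨁_j A(κ j)`.  `HC_CM` is NOT asserted. [cite: Markman2025SecantWeil, Thm 1.5.1] [cite: Pohlmann1968, Thm 1] [cite: MoonenZarhin1995Duke, Thm. 2.4]
[cite: DixonMortimer1996, §1.6, Thm. 1.6A] [cite: Shimura1998, §18.2 Lemma (i)] -/
theorem hodgeConjectureFor_biproduct_comp_of_decics_of_outside_closures (hM6 : Markman2025_weilClasses_algebraic_hyperbolicSixfold)
    {N : ℕ} (κ : Fin N → Fin (r + 1)) (h2 : Module.finrank ℚ (Kf i₀) = 2) (h10 : ∀ m : Fin r, Module.finrank ℚ (Kf (is m)) = 10)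
    (im : ∀ m : Fin r, Kf i₀ →+* Kf (is m)) (hA : ∀ j, IsCMTypeRealisation (Φ j) (A j) (ι j) (θ j)) (hΨ : ∀ σ : Kf i₀ →+* ℂ, σ ∈ (Φ 0).1 ↔ σ = τ)
    (h23 : ∀ m : Fin r, (Finset.univ.filter fun s : Kf (is m) →+* ℂ => s.comp (im m) = τ ∧ s ∈ (Φ m.succ).1).card = 2)
    (hout : ∀ (m₀ m : Fin r), m₀ ≠ m → ∃ s : Kf (is m) →+* ℂ, s.comp (im m) = τ ∧ ∃ x, s x ∉ normalClosure ℚ (Kf (is m₀)) ℂ) :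
    HodgeConjectureFor (⨁ fun j => A (κ j)).dim (⨁ fun j => A (κ j)).X := by
  obtain ⟨δ₀, d, hd, hδ₀⟩ := CyclicSextic.exists_sq_eq_neg_nat_of_isTotallyComplex (Kf i₀) h2
  obtain ⟨δ, hδ, hτ⟩ := OcticCurveFourfold.exists_delta_of_mem h2 hd hδ₀ τ
  have hdeg : ∀ m : Fin r, Module.finrank ℚ (Kf (is m)) = 2 * 5 := fun m => by rw [h10 m]
  exact hodgeConjectureFor_biproduct_comp_of_stabiliserTransitive (is := is) (n := fun _ => 5) (fun _ => 2) (fun _ => Nat.prime_five) (fun _ => Nat.succ_pos 1)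
    (fun _ => by norm_num) κ h2 hdeg im (stabiliserTransitive_of_outside_primes h2 hdeg im (fun _ => Nat.prime_five) hout) hτ hA hΨ h23
    fun m => weilHyp_of_markman_sixfold_decic_intrinsic hM6 m (h10 m) h2 hd hδ hA hΨ (h23 m)

/-- **HEADLINE — ANY NUMBER OF `(2,3)`-FIVEFOLDS OVER PAIRWISE NON-ISOMORPHIC DECIC CM FIELDS SHARING `k`, GIVEN ONLY MARKMAN'S HYPERBOLIC-SIXFOLD THEOREM.**
`k = Kf i₀` imaginary quadratic, `E = A 0 ⊨ (k; {τ})`, `F_m = A (m+1) ⊨ (K_m; Φ (m+1))` over DECIC CM fields `K_m ⊇ i_m(k)` with TWO members of `Φ (m+1)` over `τ`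
(Weil-type CM fivefolds of `k`-signature `(2,3)`), and NO ring homomorphism `K_m → K_{m₀}` for `m₀ ≠ m` (pairwise non-isomorphic fields; Galois or not, any quintic
part).  Then the Hodge conjecture holds for EVERY product of copies `E^a × ∏_m F_m^{b_m}` (any number, any order).  `HC_CM` is NOT asserted.  NOT covered: non-isogenous
fivefolds over ISOMORPHIC decic fields; `k`-signatures `(1,4)`. [cite: Markman2025SecantWeil, Thm 1.5.1] [cite: Pohlmann1968, Thm 1] [cite: MoonenZarhin1995Duke, Thm. 2.4]
[cite: Dodson1984, §1.1 Imprimitivity Theorem] [cite: Lang2002, VI §1 Thm. 1.1 and Cor. 1.6] -/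
theorem hodgeConjectureFor_biproduct_comp_of_decics_of_isEmpty_ringHom (hM6 : Markman2025_weilClasses_algebraic_hyperbolicSixfold)
    {N : ℕ} (κ : Fin N → Fin (r + 1)) (h2 : Module.finrank ℚ (Kf i₀) = 2) (h10 : ∀ m : Fin r, Module.finrank ℚ (Kf (is m)) = 10)
    (im : ∀ m : Fin r, Kf i₀ →+* Kf (is m)) (hA : ∀ j, IsCMTypeRealisation (Φ j) (A j) (ι j) (θ j)) (hΨ : ∀ σ : Kf i₀ →+* ℂ, σ ∈ (Φ 0).1 ↔ σ = τ)
    (h23 : ∀ m : Fin r, (Finset.univ.filter fun s : Kf (is m) →+* ℂ => s.comp (im m) = τ ∧ s ∈ (Φ m.succ).1).card = 2)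
    (hiso : ∀ (m₀ m : Fin r), m₀ ≠ m → IsEmpty (Kf (is m) →+* Kf (is m₀))) :
    HodgeConjectureFor (⨁ fun j => A (κ j)).dim (⨁ fun j => A (κ j)).X :=
  hodgeConjectureFor_biproduct_comp_of_decics_of_outside_closures hM6 κ h2 h10 im hA hΨ h23 (exists_outside_closures_of_pairwise_isEmpty_ringHom_five h2 h10 im hiso)

/-- **Dominated form**: every complex abelian variety dominated by such a product of copies satisfies the Hodge conjecture, given Markman's hyperbolic-sixfold theorem.
[cite: Markman2025SecantWeil, Thm 1.5.1] [cite: MumfordAV1970, §19] -/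
theorem hodgeConjectureFor_of_avDominatedBy_comp_of_decics_of_isEmpty_ringHom (hM6 : Markman2025_weilClasses_algebraic_hyperbolicSixfold)
    {N : ℕ} (κ : Fin N → Fin (r + 1)) (h2 : Module.finrank ℚ (Kf i₀) = 2) (h10 : ∀ m : Fin r, Module.finrank ℚ (Kf (is m)) = 10)
    (im : ∀ m : Fin r, Kf i₀ →+* Kf (is m)) (hA : ∀ j, IsCMTypeRealisation (Φ j) (A j) (ι j) (θ j)) (hΨ : ∀ σ : Kf i₀ →+* ℂ, σ ∈ (Φ 0).1 ↔ σ = τ)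
    (h23 : ∀ m : Fin r, (Finset.univ.filter fun s : Kf (is m) →+* ℂ => s.comp (im m) = τ ∧ s ∈ (Φ m.succ).1).card = 2)
    (hiso : ∀ (m₀ m : Fin r), m₀ ≠ m → IsEmpty (Kf (is m) →+* Kf (is m₀)))
    {X : AbelianVariety ℂ} (hX : Domination.AVDominatedBy X (⨁ fun j => A (κ j))) : HodgeConjectureFor X.dim X.X :=
  Domination.hodgeConjectureFor_of_avDominatedBy (hodgeConjectureFor_biproduct_comp_of_decics_of_isEmpty_ringHom hM6 κ h2 h10 im hA hΨ h23 hiso) hX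

end Headline

end Summit.HodgeConjecture.CorCM.MultiFieldWeil

end
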